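import Summits.MatrixMultiplication.OmegaCensus.SmallFormats.MatMul22nCheapSpans
import HarnessLib

/-!
# ω-census family (a): the COLUMN twin of `CheapSpans` — a 2-dimensional input-cheap plane pins the OUTPUT rows of its ≤ 4 terms (any field)

Cell `pub-omega` (unit `pub-omega-tensor`, gen 39), topic `Summits/MatrixMultiplication/OmegaCensus` (sub-folder
`SmallFormats`). Framing (verbatim): lottery ticket; floor = certified bounds/negative ranges. HONEST FRAMING: the W-side half of README
§Derived of tensor g39's instrument (kitjob-all4sat, `LD` variants: «rows of W_s lie in span(b₁,b₂) for s in the column plane»), obtained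
from `CheapSpans.gRow_mem_span` / `rowForm_eq_sum` (p729281) applied to the transpose-dual computation (`exists_transposeDual'`); any
field; nothing on `ω`.

* `CheapSpans.wRow_mem_span` — `|S| ≤ 4`, `ν ≠ 0`, `b 0, b 1 ∈ kⁿ` linearly independent with `g_t(ν (b m)ᵀ) = 0` for all `t ∉ S`
  (what `CheapCensus.cheapFunctionals_colPlane` (p728768) provides for a load-4 column plane at length `3n+3`): every row of every
  output `W_s`, `s ∈ S`, is a linear combination of `b 0, b 1`.
* `CheapSpans.wRow_eq_sum` — the `|S| = 3` clause: one input-cheap `b` gives `e_κ bᵀ = ∑_{t∈S} a_t W_t` for suitable coefficients.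
-/

namespace Summit.MatrixMultiplication.OmegaCensus.SmallFormats

open Finset Module Matrix
open Literature.Computability.AlgebraicComplexity
open Summit.MatrixMultiplication.OmegaCensus.RankOnePlaneCapGeneral

namespace CheapSpans

variable {k : Type*} [Field k] {n : ℕ} {ι : Type*} [Fintype ι]

/-- `g_t(ν bᵀ)` is the cheap sum of the transpose-dual computation: `∑_i b_i (ν ᵥ* G_t)_i` with `G_t μ j = g_t(E_{μ j})`. -/
theorem g_vecMulVec_eq_sum (β : BilinComp (mulBilin k 2 2 n) ι) (ν : Fin 2 → k) (b : Fin n → k) (t : ι) :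
    β.g t (Matrix.vecMulVec ν b) =
      ∑ i, b i * (Matrix.vecMul ν (Matrix.of fun μ' j => β.g t (Matrix.single μ' j (1 : k)))) i := by
  rw [dual_apply_eq_sum_single (β.g t) (Matrix.vecMulVec ν b), Finset.sum_comm]
  refine Finset.sum_congr rfl fun i _ => ?_
  simp only [Matrix.vecMul, dotProduct, Matrix.of_apply, Matrix.vecMulVec_apply, Finset.mul_sum]
  exact Finset.sum_congr rfl fun j _ => by ring

/-- The Y-form of the transpose-dual computation at an elementary matrix is the output entry: `g'_t(E_{κ j}) = W_t κ j`. -/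
theorem sum_w_mul_single (W : Matrix (Fin 2) (Fin n) k) (κ : Fin 2) (j : Fin n) :
    (∑ μ', ∑ ν', W μ' ν' * Matrix.single κ j (1 : k) μ' ν') = W κ j := by
  rw [Finset.sum_eq_single κ, Finset.sum_eq_single j]
  · simp
  · intro j' _ hj'; simp [Ne.symm hj']
  · intro h'; exact absurd (Finset.mem_univ j) h'
  · intro κ' _ hκ'; exact Finset.sum_eq_zero fun j' _ => by simp [Ne.symm hκ']
  · intro h'; exact absurd (Finset.mem_univ κ) h'

/-- **A 2-dimensional input-cheap plane pins the outputs of its `≤ 4` terms**: rows of `W_s` (`s ∈ S`) lie in `span(b 0, b 1)`. -/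
theorem wRow_mem_span (β : BilinComp (mulBilin k 2 2 n) ι) (ν : Fin 2 → k) (hν : ν ≠ 0) (S : Finset ι) (hS4 : S.card ≤ 4)
    (b : Fin 2 → (Fin n → k)) (hind : ∀ a : Fin 2 → k, ∑ m, a m • b m = 0 → ∀ m, a m = 0)
    (hcheap : ∀ t, t ∉ S → ∀ m, β.g t (Matrix.vecMulVec ν (b m)) = 0) :
    ∀ s ∈ S, ∀ κ : Fin 2, ∃ a : Fin 2 → k, β.w s κ = ∑ m, a m • b m := by
  classical
  obtain ⟨β', -, hg, hw⟩ := exists_transposeDual' β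
  have hcheap' : ∀ t, t ∉ S → ∀ m, ∑ i, b m i * (Matrix.vecMul ν (β'.w t)) i = 0 := by
    intro t ht m
    rw [hw, ← g_vecMulVec_eq_sum]
    exact hcheap t ht m
  intro s hs κ
  obtain ⟨a, ha⟩ := gRow_mem_span β' ν hν S hS4 b hind hcheap' s hs κ
  refine ⟨a, ?_⟩
  rw [← ha]
  funext j
  rw [hg, sum_w_mul_single]

/-- **One input-cheap vector** (`|S| = 3` clause): `e_κ bᵀ = ∑_{t∈S} a_t W_t` for suitable coefficients. -/
theorem wRow_eq_sum (β : BilinComp (mulBilin k 2 2 n) ι) (ν : Fin 2 → k) (hν : ν ≠ 0) (S : Finset ι)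
    (b : Fin n → k) (hcheap : ∀ t, t ∉ S → β.g t (Matrix.vecMulVec ν b) = 0) (κ : Fin 2) :
    ∃ a : ι → k, Matrix.vecMulVec (Pi.single κ (1 : k)) b = ∑ t ∈ S, a t • β.w t := by
  classical
  obtain ⟨β', -, hg, hw⟩ := exists_transposeDual' β
  have hcheap' : ∀ t, t ∉ S → ∑ i, b i * (Matrix.vecMul ν (β'.w t)) i = 0 := by
    intro t ht
    rw [hw, ← g_vecMulVec_eq_sum]
    exact hcheap t ht
  obtain ⟨a, ha⟩ := rowForm_eq_sum β' ν hν S b hcheap' κ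
  refine ⟨a, ?_⟩
  ext μ' j
  have h := ha (Matrix.single μ' j (1 : k))
  simp only [hg, sum_w_mul_single] at h
  rw [Matrix.sum_apply]
  simp only [Matrix.smul_apply, smul_eq_mul, Matrix.vecMulVec_apply, Pi.single_apply]
  have lhs : (∑ i, b i * Matrix.single μ' j (1 : k) κ i) = if κ = μ' then b j else 0 := by
    by_cases hk : κ = μ'
    · subst hk
      rw [if_pos rfl, Finset.sum_eq_single j]
      · simp
      · intro i _ hi; simp [Ne.symm hi]
      · intro h'; exact absurd (Finset.mem_univ j) h'
    · rw [if_neg hk]; exact Finset.sum_eq_zero fun i _ => by simp [Ne.symm hk]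
  rw [lhs] at h
  by_cases hk : κ = μ'
  · subst hk
    rw [if_pos rfl] at h
    rw [if_pos rfl, one_mul]
    exact h
  · rw [if_neg hk] at h
    rw [if_neg (Ne.symm hk), zero_mul]
    exact h

end CheapSpans

end Summit.MatrixMultiplication.OmegaCensus.SmallFormats
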